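import Mathlib
import HarnessLib
import Literature.NumberTheory.DiophantineGeometry.BelyiPairAscent

/-!
# No deep points: the inductions

(Layer 3d of the bad-prime floor for the Belyi degree.)  Combining the descent and ascent steps:
a tame Belyi pair with a special point in the closed unit disc is never deep at the Gauss point
(`IsBelyiPair.not_isDeepPair`: downward induction on the number of special points in the disc,
upward induction on the number outside), and consequently never *fully neutral*
(`IsBelyiPair.not_fullyNeutral`: the reductions of `p`, `q`, `p - q` are not all equal; a fully
neutral point is deep for a centre read off from the region of the Gauss point,
`IsBelyiPair.isDeepPair_of_fullyNeutral`).  Geometrically: the image of every point of the skeleton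
of the special points lies on the tripod spanned by `0, 1, ∞`.

Folklore (cf. Zannier, Israel J. Math. 124 (2001)); everything proved, no named facts.
-/

noncomputable section

namespace Literature.NumberTheory.DiophantineGeometry

open Polynomial IsLocalRing Literature.RingTheory.Valuation
open scoped Classical

section Counting

variable {K : Type*} [Field K] [IsAlgClosed K] [CharZero K] (A : ValuationSubring K)
variable {d : ℕ} {p q : K[X]}

omit [IsAlgClosed K] [CharZero K] in
/-- The special points of a rescaled pair are the rescaled special points. [folklore] -/
theorem roots_prod_comp (p q : K[X]) (s₀ : K) {c : K} (hc : c ≠ 0) :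
    (p.comp (C s₀ + C c * X) * q.comp (C s₀ + C c * X) *
        (p.comp (C s₀ + C c * X) - q.comp (C s₀ + C c * X))).roots =
      (p * q * (p - q)).roots.map fun s => c⁻¹ * (s - s₀) := by
  have key : p.comp (C s₀ + C c * X) * q.comp (C s₀ + C c * X) *
      (p.comp (C s₀ + C c * X) - q.comp (C s₀ + C c * X)) = (p * q * (p - q)).comp (C s₀ + C c * X) := by
    rw [mul_comp, mul_comp, sub_comp]
  rw [key, roots_comp_C_add_C_mul_X _ _ hc]

omit [IsAlgClosed K] [CharZero K] in
/-- Membership of a rescaled point in `A`. [folklore] -/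
theorem mem_rescale_iff (s₀ : K) {c : K} (hc : c ≠ 0) (s : K) :
    c⁻¹ * (s - s₀) ∈ A ↔ A.valuation (s - s₀) ≤ A.valuation c := by
  have hvc : A.valuation c ≠ 0 := (Valuation.ne_zero_iff _).mpr hc
  rw [← A.valuation_le_one_iff, map_mul, map_inv₀, inv_mul_le_iff₀ (zero_lt_iff.mpr hvc), mul_one]

omit [IsAlgClosed K] [CharZero K] in
/-- Special points of the rescaled pair in the unit disc = special points in `D(s₀, v c)`.
[folklore] -/
theorem nSpecIn_comp (p q : K[X]) (s₀ : K) {c : K} (hc : c ≠ 0) :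
    nSpecIn A (p.comp (C s₀ + C c * X)) (q.comp (C s₀ + C c * X)) =
      ((p * q * (p - q)).roots.toFinset.filter fun s => A.valuation (s - s₀) ≤ A.valuation c).card := by
  unfold nSpecIn
  rw [roots_prod_comp p q s₀ hc, Multiset.toFinset_map, Finset.filter_image,
    Finset.card_image_of_injective]
  · congr 1
    exact Finset.filter_congr fun s _ => mem_rescale_iff A s₀ hc s
  · intro x y hxy
    have := mul_left_cancel₀ (inv_ne_zero hc) hxy
    simpa using this

omit [IsAlgClosed K] [CharZero K] in
/-- Special points of the rescaled pair outside the unit disc = special points outside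
`D(s₀, v c)`. [folklore] -/
theorem nSpecOut_comp (p q : K[X]) (s₀ : K) {c : K} (hc : c ≠ 0) :
    nSpecOut A (p.comp (C s₀ + C c * X)) (q.comp (C s₀ + C c * X)) =
      ((p * q * (p - q)).roots.toFinset.filter fun s => A.valuation c < A.valuation (s - s₀)).card := by
  unfold nSpecOut
  rw [roots_prod_comp p q s₀ hc, Multiset.toFinset_map, Finset.filter_image,
    Finset.card_image_of_injective]
  · congr 1
    refine Finset.filter_congr fun s _ => ?_
    rw [mem_rescale_iff A s₀ hc s, not_le]
  · intro x y hxy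
    have := mul_left_cancel₀ (inv_ne_zero hc) hxy
    simpa using this

omit [IsAlgClosed K] [CharZero K] in
/-- `0` is a special point of the pair rescaled at a special point `s₀`. [folklore] -/
theorem zero_mem_roots_prod_comp {p q : K[X]} {s₀ : K} (hs₀ : s₀ ∈ (p * q * (p - q)).roots) {c : K}
    (hc : c ≠ 0) :
    (0 : K) ∈ (p.comp (C s₀ + C c * X) * q.comp (C s₀ + C c * X) *
      (p.comp (C s₀ + C c * X) - q.comp (C s₀ + C c * X))).roots := by
  rw [roots_prod_comp p q s₀ hc, Multiset.mem_map]
  exact ⟨s₀, hs₀, by rw [sub_self, mul_zero]⟩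

omit [IsAlgClosed K] [CharZero K] in
/-- `1` is a special point of the pair rescaled at `s₀` by `c` when `s₀ + c` is special. [folklore] -/
theorem one_mem_roots_prod_comp {p q : K[X]} {s₀ c : K} (hs : s₀ + c ∈ (p * q * (p - q)).roots)
    (hc : c ≠ 0) :
    (1 : K) ∈ (p.comp (C s₀ + C c * X) * q.comp (C s₀ + C c * X) *
      (p.comp (C s₀ + C c * X) - q.comp (C s₀ + C c * X))).roots := by
  rw [roots_prod_comp p q s₀ hc, Multiset.mem_map]
  exact ⟨s₀ + c, hs, by rw [add_sub_cancel_left, inv_mul_cancel₀ hc]⟩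

end Counting

/-! ### The inductions -/

section Induction

variable {K : Type*} [Field K] [IsAlgClosed K] [CharZero K] (A : ValuationSubring K)

/-- **Downward induction.**  A tame deep Belyi pair with a special point in the unit disc for which
`∞` is a pole of the reduction is impossible: by the all-shallow contradiction some class is not a
pole, and the descent step produces a deep pair of the same kind on a strictly smaller cluster.
[folklore] -/
theorem not_deep_of_outer_shallow {d : ℕ} (htame : ∀ n : ℕ, 0 < n → n ≤ d → (n : ResidueField A) ≠ 0) :
    ∀ (N : ℕ) (p q : K[X]), IsBelyiPair d p q → IsDeepPair A p q →
      (∃ s ∈ (p * q * (p - q)).roots, s ∈ A) →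
      Multiset.card (intRoots A q) < Multiset.card (intRoots A (p - C (centre A p q) * q)) →
      2 * nSpecIn A p q + (if IsClusterPair A p q then 0 else 1) = N → False := by
  intro N
  induction N using Nat.strong_induction_on with
  | _ N ih =>
  intro p q h hdeep hspec houter hN
  obtain ⟨s, hsF, hsA⟩ := hspec
  -- some class with special points is not a pole of the reduction
  have hv₀ := IsDeepPair.count_redRoots_pos_of_mem_roots A hdeep h hsF hsA
  have hex : ∃ v, 0 < (redRoots A q).count v ∧
      (redPoly A q).rootMultiplicity v ≤ (redPoly A (p - C (centre A p q) * q)).rootMultiplicity v := by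
    by_contra hnone
    push Not at hnone
    exact h.false_of_forall_shallow A htame hdeep hv₀ (fun v hv => hnone v hv) houter
  obtain ⟨v, hv0, hv⟩ := hex
  obtain ⟨s₀, c₁, hs₀F, ⟨hs₀A, hres₀⟩, hc₁0, hc₁1, hs₁F, hclass, hdeep', houter'⟩ :=
    h.descend A htame hdeep hv0 hv
  set L : K[X] := C s₀ + C c₁ * X with hL
  have h' : IsBelyiPair d (p.comp L) (q.comp L) := h.comp s₀ hc₁0
  -- the measure decreases
  have hsub : ((p * q * (p - q)).roots.toFinset.filter fun s => A.valuation (s - s₀) ≤ A.valuation c₁) ⊆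
      (p * q * (p - q)).roots.toFinset.filter (· ∈ A) := by
    intro x hx
    rw [Finset.mem_filter] at hx ⊢
    refine ⟨hx.1, (mem_iff_valuation_sub_le_one A hs₀A x).mpr (hx.2.trans hc₁1.le)⟩
  have hle : nSpecIn A (p.comp L) (q.comp L) ≤ nSpecIn A p q := by
    rw [hL, nSpecIn_comp A p q s₀ hc₁0]; exact Finset.card_le_card hsub
  have hcluster' : IsClusterPair A (p.comp L) (q.comp L) := by
    refine ⟨0, zero_mem_roots_prod_comp hs₀F hc₁0, 1, one_mem_roots_prod_comp hs₁F hc₁0,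
      A.zero_mem, A.one_mem, ?_⟩
    intro heq
    have h0 : residue A (⟨0, A.zero_mem⟩ : A) = 0 := map_zero _
    have h1 : residue A (⟨1, A.one_mem⟩ : A) = 1 := map_one _
    rw [h0, h1] at heq
    exact zero_ne_one heq
  have hlt : 2 * nSpecIn A (p.comp L) (q.comp L) + (if IsClusterPair A (p.comp L) (q.comp L) then 0 else 1) <
      N := by
    rw [if_pos hcluster', add_zero, ← hN]
    by_cases hcl : IsClusterPair A p q
    · -- a special point with residue `≠ v` drops out
      rw [if_pos hcl, add_zero]
      obtain ⟨x, hxF, y, hyF, hxA, hyA, hxy⟩ := hcl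
      have hdrop : ∃ z ∈ (p * q * (p - q)).roots, ∃ hz : z ∈ A, residue A ⟨z, hz⟩ ≠ v := by
        by_cases hx : residue A ⟨x, hxA⟩ = v
        · exact ⟨y, hyF, hyA, fun hy => hxy (hx.trans hy.symm)⟩
        · exact ⟨x, hxF, hxA, hx⟩
      obtain ⟨z, hzF, hzA, hzv⟩ := hdrop
      have hzmem : z ∈ (p * q * (p - q)).roots.toFinset.filter (· ∈ A) :=
        Finset.mem_filter.mpr ⟨Multiset.mem_toFinset.mpr hzF, hzA⟩
      have hznot : z ∉ (p * q * (p - q)).roots.toFinset.filter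
          fun s => A.valuation (s - s₀) ≤ A.valuation c₁ := by
        intro hz
        rw [Finset.mem_filter] at hz
        obtain ⟨_, hres⟩ := mem_and_residue_eq_of_valuation_sub_lt_one A hs₀A (lt_of_le_of_lt hz.2 hc₁1)
        exact hzv (hres.trans hres₀)
      have hlt' : nSpecIn A (p.comp L) (q.comp L) < nSpecIn A p q := by
        rw [hL, nSpecIn_comp A p q s₀ hc₁0]
        exact Finset.card_lt_card (Finset.ssubset_iff_subset_ne.mpr ⟨hsub, fun heq => hznot (heq ▸ hzmem)⟩)
      omega
    · rw [if_neg hcl]; omega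
  exact ih _ hlt (p.comp L) (q.comp L) h' hdeep' ⟨0, zero_mem_roots_prod_comp hs₀F hc₁0, A.zero_mem⟩
    houter' rfl

/-- **Upward induction.**  A tame deep Belyi pair with a special point in the unit disc is
impossible: if `∞` is a pole of the reduction use the downward induction, otherwise the ascent step
produces a deep pair with strictly fewer special points outside its unit disc. [folklore] -/
theorem not_deep_aux {d : ℕ} (htame : ∀ n : ℕ, 0 < n → n ≤ d → (n : ResidueField A) ≠ 0) :
    ∀ (M : ℕ) (p q : K[X]), IsBelyiPair d p q → IsDeepPair A p q →
      (∃ s ∈ (p * q * (p - q)).roots, s ∈ A) → nSpecOut A p q = M → False := by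
  intro M
  induction M using Nat.strong_induction_on with
  | _ M ih =>
  intro p q h hdeep hspec hM
  by_cases houter : Multiset.card (intRoots A q) < Multiset.card (intRoots A (p - C (centre A p q) * q))
  · exact not_deep_of_outer_shallow A htame _ p q h hdeep hspec houter rfl
  rw [not_lt] at houter
  obtain ⟨s₀, hs₀F, hs₀A⟩ := hspec
  obtain ⟨c', hc'1, hs'F, hmin, hdeep'⟩ := h.ascend A htame hdeep houter hs₀F hs₀A
  have hc'0 : c' ≠ 0 := by
    intro h0; rw [h0, map_zero] at hc'1; exact (not_lt.mpr zero_le) hc'1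
  set L : K[X] := C s₀ + C c' * X with hL
  have h' : IsBelyiPair d (p.comp L) (q.comp L) := h.comp s₀ hc'0
  have hlt : nSpecOut A (p.comp L) (q.comp L) < M := by
    rw [← hM, hL, nSpecOut_comp A p q s₀ hc'0]
    unfold nSpecOut
    apply Finset.card_lt_card
    rw [Finset.ssubset_iff_subset_ne]
    constructor
    · intro x hx
      rw [Finset.mem_filter] at hx ⊢
      refine ⟨hx.1, fun hxA => ?_⟩
      have := (mem_iff_valuation_sub_le_one A hs₀A x).mp hxA
      exact absurd (lt_of_lt_of_le hc'1 hx.2.le) (not_lt.mpr this)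
    · intro heq
      have hmem : s₀ + c' ∈ (p * q * (p - q)).roots.toFinset.filter (· ∉ A) := by
        rw [Finset.mem_filter, Multiset.mem_toFinset, mem_iff_valuation_sub_le_one A hs₀A, not_le,
          add_sub_cancel_left]
        exact ⟨hs'F, hc'1⟩
      rw [← heq, Finset.mem_filter, add_sub_cancel_left] at hmem
      exact lt_irrefl _ hmem.2
  exact ih _ hlt (p.comp L) (q.comp L) h' hdeep' ⟨0, zero_mem_roots_prod_comp hs₀F hc'0, A.zero_mem⟩ rfl

variable {d : ℕ} {p q : K[X]}

/-- **No deep points.**  A tame Belyi pair with a special point in the closed unit disc is never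
deep at the Gauss point: `gaussVal (p - a q) ≥ r_Y(a) · gaussVal q` for every `a ∈ K`.  (The image
of the Gauss point of any disc centred at a special point lies on the tripod spanned by `0, 1, ∞`.)
[folklore] -/
theorem IsBelyiPair.not_isDeepPair (h : IsBelyiPair d p q)
    (htame : ∀ n : ℕ, 0 < n → n ≤ d → (n : ResidueField A) ≠ 0) {s : K}
    (hs : s ∈ (p * q * (p - q)).roots) (hsA : s ∈ A) : ¬ IsDeepPair A p q := fun hdeep =>
  not_deep_aux A htame _ p q h hdeep ⟨s, hs, hsA⟩ rfl

omit [CharZero K] in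
/-- **Difference of models.**  If `f, g` have the same reduction there is a constant `a` with
`v(a) · gaussVal g = gaussVal f` and `gaussVal (f - a g) < gaussVal f`. [folklore] -/
theorem exists_gaussVal_sub_C_mul_lt {f g : K[X]} (hf : f ≠ 0) (hg : g ≠ 0)
    (hred : redPoly A f = redPoly A g) :
    ∃ a : K, A.valuation a * gaussVal A g = gaussVal A f ∧ gaussVal A (f - C a * g) < gaussVal A f := by
  obtain ⟨c₁, hc₁, g₁, hg₁f, hg₁r⟩ := exists_model A hf (IsAlgClosed.splits f)
  obtain ⟨c₂, hc₂, g₂, hg₂f, hg₂r⟩ := exists_model A hg (IsAlgClosed.splits g)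
  have h1 : A.valuation c₁ * gaussVal A f = 1 := valuation_mul_gaussVal_eq_one hg₁f hg₁r
  have h2 : A.valuation c₂ * gaussVal A g = 1 := valuation_mul_gaussVal_eq_one hg₂f hg₂r
  have hdiff : (g₁ - g₂).map (residue A) = 0 := by rw [Polynomial.map_sub, hg₁r, hg₂r, hred, sub_self]
  have hlt : gaussVal A ((g₁ - g₂).map (algebraMap A K)) < 1 := (gaussVal_map_lt_one_iff A _).mpr hdiff
  have hmap : (g₁ - g₂).map (algebraMap A K) = C c₁ * (f - C (c₂ / c₁) * g) := by
    rw [Polynomial.map_sub, hg₁f, hg₂f, mul_sub, ← mul_assoc, ← C_mul, mul_div_cancel₀ _ hc₁]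
  rw [hmap, gaussVal_C_mul] at hlt
  have hvc₁ : A.valuation c₁ ≠ 0 := (Valuation.ne_zero_iff _).mpr hc₁
  refine ⟨c₂ / c₁, ?_, ?_⟩
  · apply mul_left_cancel₀ hvc₁
    rw [← mul_assoc, map_div₀, mul_div_cancel₀ _ hvc₁, h2, h1]
  · rw [← h1] at hlt
    exact lt_of_mul_lt_mul_left' hlt

omit [CharZero K] in
/-- **Fully neutral implies deep.**  If the three reductions `redPoly p`, `redPoly q`,
`redPoly (p - q)` coincide, the Gauss point is deep (for a centre read off from the region of the
Gauss point: the ratio of the model constants of `p, q`, or `1 +` that of `p - q, q`). [folklore] -/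
theorem IsBelyiPair.isDeepPair_of_fullyNeutral (h : IsBelyiPair d p q)
    (hpq : redPoly A p = redPoly A q) (hrq : redPoly A (p - q) = redPoly A q) : IsDeepPair A p q := by
  have hp0 := h.left_ne_zero
  have hq0 := h.right_ne_zero
  have hr0 := h.sub_ne_zero
  have hgq : 0 < gaussVal A q := zero_lt_iff.mpr (gaussVal_ne_zero A hq0)
  obtain ⟨a, hva, hlt⟩ := exists_gaussVal_sub_C_mul_lt A hp0 hq0 hpq
  by_cases hpq' : gaussVal A p = gaussVal A q
  · have hva1 : A.valuation a = 1 := by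
      rw [hpq'] at hva; exact mul_right_cancel₀ hgq.ne' (hva.trans (one_mul _).symm)
    by_cases hrq' : gaussVal A (p - q) = gaussVal A q
    · -- central region: `v(a - 1) = 1` as well
      refine ⟨a, ?_⟩
      have hva1' : A.valuation (a - 1) = 1 := by
        apply le_antisymm
        · exact (A.valuation.map_sub a 1).trans (max_le hva1.le (by rw [map_one]))
        · by_contra hlt1
          rw [not_le] at hlt1
          have : gaussVal A (p - q) < gaussVal A q := by
            have e : p - q = (p - C a * q) + C (a - 1) * q := by rw [map_sub, C_1]; ring
            rw [e]
            refine lt_of_le_of_lt (gaussVal_add_le A _ _) (max_lt ?_ ?_)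
            · rw [← hpq']; exact hlt
            · rw [gaussVal_C_mul]
              calc A.valuation (a - 1) * gaussVal A q < 1 * gaussVal A q :=
                    mul_lt_mul_of_pos_right hlt1 hgq
                _ = gaussVal A q := one_mul _
          exact (lt_irrefl _) (hrq' ▸ this)
      rw [rY, hva1, hva1', min_self, one_mul, ← hpq']
      exact hlt
    · -- `1`-region: use the models of `p - q` and `q`
      obtain ⟨a', hva', hlt'⟩ := exists_gaussVal_sub_C_mul_lt A hr0 hq0 hrq
      have hrlt : gaussVal A (p - q) < gaussVal A q := by
        refine lt_of_le_of_ne ?_ hrq'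
        exact (gaussVal_sub_le A p q).trans (by rw [hpq', max_self])
      have hva'1 : A.valuation a' < 1 := by
        by_contra hge
        rw [not_lt] at hge
        have : gaussVal A q ≤ gaussVal A (p - q) := by
          rw [← hva']; exact le_mul_of_one_le_left' hge
        exact (not_lt.mpr this) hrlt
      refine ⟨1 + a', ?_⟩
      have e : p - C (1 + a') * q = (p - q) - C a' * q := by rw [map_add, C_1]; ring
      have hrY : rY A (1 + a') = A.valuation a' := by
        rw [rY, add_sub_cancel_left]
        refine min_eq_right ?_
        rw [A.valuation.map_add_eq_of_lt_left (by rw [map_one]; exact hva'1), map_one]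
        exact hva'1.le
      rw [e, hrY, hva']
      exact hlt'
  · -- `0`- or `∞`-region: `v a ≠ 1` and `r_Y(a) = v a`
    refine ⟨a, ?_⟩
    have hva1 : A.valuation a ≠ 1 := by
      intro h1; rw [h1, one_mul] at hva; exact hpq' hva.symm
    have hrY : rY A a = A.valuation a := by
      rw [rY]
      refine min_eq_left ?_
      rcases lt_or_gt_of_ne hva1 with hlt1 | hgt1
      · rw [Valuation.map_sub_swap, sub_eq_add_neg,
          A.valuation.map_add_eq_of_lt_left (by rw [Valuation.map_neg, map_one]; exact hlt1), map_one]
        exact hlt1.le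
      · rw [sub_eq_add_neg, A.valuation.map_add_eq_of_lt_left (by rw [Valuation.map_neg, map_one]; exact hgt1)]
    rw [hrY, hva]
    exact hlt

/-- **Fully neutral points do not exist.**  For a tame Belyi pair with a special point in the unit
disc, the three reductions `redPoly p`, `redPoly q`, `redPoly (p - q)` are not all equal.
[folklore] -/
theorem IsBelyiPair.not_fullyNeutral (h : IsBelyiPair d p q)
    (htame : ∀ n : ℕ, 0 < n → n ≤ d → (n : ResidueField A) ≠ 0) {s : K}
    (hs : s ∈ (p * q * (p - q)).roots) (hsA : s ∈ A) :
    ¬ (redPoly A p = redPoly A q ∧ redPoly A (p - q) = redPoly A q) := fun hn =>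
  h.not_isDeepPair A htame hs hsA (h.isDeepPair_of_fullyNeutral A hn.1 hn.2)

end Induction

end Literature.NumberTheory.DiophantineGeometry

end
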